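import Summits.AnomalousDissipation.AnomalousDissipation.Theorems.SolenoidalFractalHomogenisationLagrangianStepCellCorrectorContent
import HarnessLib

/-!
# K1L `LagrangianRenormalisationStep(Design)` (stmt-AnomalousDissipation-24912 → K1L_D stmt-AnomalousDissipation-27980), stub `stub_cellEnergyT`
# (clause (F) uniform in `T`, finding F-p4g10-1): the SECTOR COUNT — pair-sectors of distinct slow pairs are disjoint, so their energies sum to at
# most `2‖F‖²` (helper; `--supports … --as helper`; S-item `SectorCount` of p4 g10's typed split, with its bookkeeping definitions)

Summits-side helper file of route `SolenoidalFractalHomogenisation` (three bookkeeping definitions `slowBox` / `PairSector` / `pairSectorEnergy` of the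
typed split + proved lemmas; no named facts, no sorry).  The typed split `UniformSlowLeak ⇐ SlowModeBound + SectorCount + MeanConservation` of
`Cruxes/LagrangianRenormalisationStep/DualLeakageSketch.lean` §4 (planner ad-ideate-p4 g10, v3 sha16 9fb1fcf710fcd042, cell STATUS 2026-08-28T13:43:50Z /
13:49:46Z «copy verbatim into a Theorems file (swap the namespace; `slowBox`/`PairSector`/`pairSectorEnergy` defs come along)») asks for

  `SectorCount :⇔ ∀ n L, 0 < L → 2L < n → ∀ F, IsDatum F → Σ_{ℓ ∈ slowBox L ∖ {0}} pairSectorEnergy n ℓ F ≤ 2 ∫‖F‖²`.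

`sum_pairSectorEnergy_le` below has EXACTLY that body over the definitions landed here (texts verbatim from the sketch, p4 g10's reference proof:
two slow frequencies congruent modulo the cell grid coincide, `|ℓᵢ − ℓ'ᵢ| ≤ 2L < n` (`eq_of_slow_congr`); hence every frequency lies in at most two
slow pair-sectors (`sum_indicator_pairSector_le`, `Finset.card_le_one` twice); Parseval `Torus.hasSum_sq_norm_mFourierCoeff_complexify` + `sectorEnergy_eq`
(p634914) + `tsum_subtype` / `Summable.tsum_finsetSum` / `Summable.tsum_le_tsum`), so `sectorCount : SectorCount := sum_pairSectorEnergy_le` is a one-liner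
wherever the Prop is landed; sibling of `…LagrangianStepMeanConservation` (p638532).  Infrastructure for route-1's rung leaf F-D1.A0 (a frontier FORMAL
rung); NOT a proof of the stub, of the crux, of Onsager's conjecture or of anomalous dissipation.  Prover seat `ad-k3l-bookkeeping-p1` g3 (idle-prover
S-item; author of the texts: planner ad-ideate-p4 g10), 2026-08-28.
-/

set_option linter.dupNamespace false

noncomputable section

namespace Summit.AnomalousDissipation.AnomalousDissipation.Theorems.SolenoidalFractalHomogenisation.LagrangianStep

open Literature.Analysis Literature.Analysis.FluidPDE Literature.Analysis.FunctionSpaces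
open Literature.Analysis.FluidPDE.LatticeShear
open MeasureTheory Set Filter Function UnitAddTorus
open scoped ENNReal NNReal InnerProductSpace Topology
open Summit.AnomalousDissipation.AnomalousDissipation.Theorems.SolenoidalFractalHomogenisation.RealisedQuasiStaticCellLaw

/-! ## The slow box and the pair-sectors (bookkeeping definitions of the typed split) -/

/-- The slow box of `lowEnergy L` (its index Finset, verbatim). -/
def slowBox (L : ℝ) : Finset (Fin 3 → ℤ) :=
  (Fintype.piFinset fun _ : Fin 3 => Finset.Icc (-⌈L⌉) ⌈L⌉).filter (fun k => ‖Torus.latticeVec k‖ ≤ L)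

/-- `lowEnergy L` is the sum of the sector energies over the slow box. [folklore] -/
theorem lowEnergy_eq_sum (L : ℝ) (f : VF) : lowEnergy L f = ∑ k ∈ slowBox L, sectorEnergy k f := rfl

/-- The zero frequency lies in every slow box with `L ≥ 0`. [folklore] -/
theorem zero_mem_slowBox {L : ℝ} (hL : 0 ≤ L) : (0 : Fin 3 → ℤ) ∈ slowBox L := by
  refine Finset.mem_filter.2 ⟨Fintype.mem_piFinset.2 fun i => Finset.mem_Icc.2 ⟨?_, ?_⟩, ?_⟩
  · simp only [Pi.zero_apply, Left.neg_nonpos_iff]; exact Int.ceil_nonneg hL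
  · simp only [Pi.zero_apply]; exact Int.ceil_nonneg hL
  · rw [Torus.latticeVec_zero, norm_zero]; exact hL

/-- Frequencies of the slow box have norm at most `L`. [folklore] -/
theorem norm_le_of_mem_slowBox {L : ℝ} {ℓ : Fin 3 → ℤ} (h : ℓ ∈ slowBox L) : ‖Torus.latticeVec ℓ‖ ≤ L :=
  (Finset.mem_filter.1 h).2

/-- The pair-sector `{±ℓ} + nℤ³` of the frequency `ℓ`. -/
def PairSector (n : ℕ) (ℓ : Fin 3 → ℤ) : Set (Fin 3 → ℤ) :=
  {k' | (∀ i, (n:ℤ) ∣ k' i - ℓ i) ∨ ∀ i, (n:ℤ) ∣ k' i + ℓ i}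

/-- The energy of `F` carried by the pair-sector of `ℓ` (`‖P_{Σ(ℓ)}F‖²`; summable for `F ∈ L²`). -/
def pairSectorEnergy (n : ℕ) (ℓ : Fin 3 → ℤ) (F : VF) : ℝ := ∑' k' : PairSector n ℓ, sectorEnergy (k' : Fin 3 → ℤ) F

/-- Pair-sector energies are nonnegative. [folklore] -/
theorem pairSectorEnergy_nonneg (n : ℕ) (ℓ : Fin 3 → ℤ) (F : VF) : 0 ≤ pairSectorEnergy n ℓ F :=
  tsum_nonneg fun _ => sectorEnergy_nonneg _ _

/-! ## The count -/

/-- Two slow frequencies congruent modulo the cell grid coincide (`|ℓᵢ − ℓ'ᵢ| ≤ 2L < n`). [folklore] -/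
theorem eq_of_slow_congr {n : ℕ} {L : ℝ} (hLn : 2 * L < n) {ℓ ℓ' : Fin 3 → ℤ} (hℓ : ℓ ∈ slowBox L) (hℓ' : ℓ' ∈ slowBox L)
    (h : ∀ i, (n:ℤ) ∣ ℓ i - ℓ' i) : ℓ = ℓ' := by
  funext i
  have h1 : |(ℓ i : ℝ)| ≤ L := (abs_coord_le_norm_latticeVec ℓ i).trans (norm_le_of_mem_slowBox hℓ)
  have h2 : |(ℓ' i : ℝ)| ≤ L := (abs_coord_le_norm_latticeVec ℓ' i).trans (norm_le_of_mem_slowBox hℓ')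
  have h3 : |((ℓ i - ℓ' i : ℤ) : ℝ)| < n := by
    push_cast
    exact (abs_sub _ _).trans_lt (by linarith)
  have h4 : |ℓ i - ℓ' i| < (n:ℤ) := by exact_mod_cast h3
  exact sub_eq_zero.1 (Int.eq_zero_of_abs_lt_dvd (h i) h4)

/-- Pointwise sector count: a frequency `k'` lies in at most two pair-sectors `Σ(ℓ)`, `0 ≠ ℓ` slow. [folklore] -/
theorem sum_indicator_pairSector_le {n : ℕ} {L : ℝ} (hLn : 2 * L < n) {e : (Fin 3 → ℤ) → ℝ} (he : ∀ k, 0 ≤ e k)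
    (k' : Fin 3 → ℤ) : ∑ ℓ ∈ (slowBox L).erase 0, (PairSector n ℓ).indicator e k' ≤ 2 * e k' := by
  classical
  set B := (slowBox L).erase 0 with hB
  have hsplit : ∀ ℓ ∈ B, (PairSector n ℓ).indicator e k' ≤
      (if (∀ i, (n:ℤ) ∣ k' i - ℓ i) then e k' else 0) + (if (∀ i, (n:ℤ) ∣ k' i + ℓ i) then e k' else 0) := by
    intro ℓ _
    rw [Set.indicator_apply]
    simp only [PairSector, Set.mem_setOf_eq]
    have := he k'
    split_ifs <;> first | linarith | tauto
  refine (Finset.sum_le_sum hsplit).trans ?_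
  rw [Finset.sum_add_distrib, ← Finset.sum_filter, ← Finset.sum_filter, Finset.sum_const, Finset.sum_const, nsmul_eq_mul,
    nsmul_eq_mul]
  have hc1 : (B.filter fun ℓ => ∀ i, (n:ℤ) ∣ k' i - ℓ i).card ≤ 1 := by
    refine Finset.card_le_one.2 fun a ha b hb => ?_
    rw [Finset.mem_filter] at ha hb
    refine eq_of_slow_congr hLn (Finset.mem_of_mem_erase ha.1) (Finset.mem_of_mem_erase hb.1) fun i => ?_
    have := dvd_sub (hb.2 i) (ha.2 i)
    rwa [show k' i - b i - (k' i - a i) = a i - b i by ring] at this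
  have hc2 : (B.filter fun ℓ => ∀ i, (n:ℤ) ∣ k' i + ℓ i).card ≤ 1 := by
    refine Finset.card_le_one.2 fun a ha b hb => ?_
    rw [Finset.mem_filter] at ha hb
    refine eq_of_slow_congr hLn (Finset.mem_of_mem_erase ha.1) (Finset.mem_of_mem_erase hb.1) fun i => ?_
    have := dvd_sub (ha.2 i) (hb.2 i)
    rwa [show k' i + a i - (k' i + b i) = a i - b i by ring] at this
  have h1 : ((B.filter fun ℓ => ∀ i, (n:ℤ) ∣ k' i - ℓ i).card : ℝ) ≤ 1 := by exact_mod_cast hc1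
  have h2 : ((B.filter fun ℓ => ∀ i, (n:ℤ) ∣ k' i + ℓ i).card : ℝ) ≤ 1 := by exact_mod_cast hc2
  have := he k'
  nlinarith

/-- **The sector count (the text of p4 g10's `SectorCount`), PROVED** — Parseval (`Torus.hasSum_sq_norm_mFourierCoeff_complexify`) and the
pointwise count `sum_indicator_pairSector_le`: `Σ_{0 ≠ ℓ ∈ slowBox L} ‖P_{Σ(ℓ)}F‖² ≤ 2‖F‖²` for `2L < n`. [cite: Grafakos2014, Prop. 3.2.7 (3)] -/
theorem sum_pairSectorEnergy_le :
    ∀ (n : ℕ) (L : ℝ), 0 < L → 2 * L < n → ∀ F : VF, IsDatum F →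
      ∑ ℓ ∈ (slowBox L).erase 0, pairSectorEnergy n ℓ F ≤ 2 * ∫ x, ‖F x‖ ^ 2 := by
  intro n L hL hLn F hF
  classical
  have hF2 : MemLp F 2 volume := memLp_two_of_memSobolev_one_complexify hF.1
  have hFi : Integrable F volume := hF2.integrable one_le_two
  -- Parseval for `e k = sectorEnergy k F`
  have hPars : HasSum (fun k : Fin 3 → ℤ => sectorEnergy k F) (∫ x, ‖F x‖ ^ 2) := by
    have h := FunctionSpaces.Torus.hasSum_sq_norm_mFourierCoeff_complexify hF2
    convert h using 1
    funext k
    exact sectorEnergy_eq hFi k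
  have hsum : Summable fun k : Fin 3 → ℤ => sectorEnergy k F := hPars.summable
  have hind : ∀ ℓ, Summable ((PairSector n ℓ).indicator fun k => sectorEnergy k F) := fun ℓ => hsum.indicator _
  -- rewrite each pair-sector energy as an indicator sum and interchange
  have hps : ∀ ℓ, pairSectorEnergy n ℓ F = ∑' k, (PairSector n ℓ).indicator (fun k => sectorEnergy k F) k := fun ℓ =>
    tsum_subtype (PairSector n ℓ) (fun k => sectorEnergy k F)
  simp_rw [hps]
  rw [← Summable.tsum_finsetSum (fun ℓ _ => hind ℓ)]
  calc ∑' k, ∑ ℓ ∈ (slowBox L).erase 0, (PairSector n ℓ).indicator (fun k => sectorEnergy k F) k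
      ≤ ∑' k, 2 * sectorEnergy k F :=
        Summable.tsum_le_tsum (fun k => sum_indicator_pairSector_le hLn (fun k => sectorEnergy_nonneg k F) k)
          (summable_sum fun ℓ _ => hind ℓ) (hsum.mul_left 2)
    _ = 2 * ∫ x, ‖F x‖ ^ 2 := by rw [tsum_mul_left, hPars.tsum_eq]


end Summit.AnomalousDissipation.AnomalousDissipation.Theorems.SolenoidalFractalHomogenisation.LagrangianStep

end
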